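import Mathlib
import Literature.Computability.AlgebraicComplexity.BurgisserBooleanPartsModPCircuits
import Literature.Computability.AlgebraicComplexity.SignedWordCircuits
import Summits.ValiantsHypothesis.ValiantsHypothesis.Theorems.NumTameDefs
import Summits.ValiantsHypothesis.ValiantsHypothesis.Theorems.NumTameGaussWordCircuits
import HarnessLib

/-!
# Route NumTame — `B₂`-circuits for the clamped fixed-point run of a fan-in-two circuit
# (support for crux TameA3, stmt-ValiantsHypothesis-5386, registered stub `stub_gates`)

Gate-by-gate Boolean simulation of `FixedPoint.gateValuesFx I B x P.gates` (line `birth` of crux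
`TameA3`): with word width `W ≥ 2 (I + B) + 4` every Gaussian integer of the run travels as the
pair of two's complement words `FixedPoint.gaussBits W ·` on the bus
`FixedPoint.fxBus W x (gateValuesFx I B x gs) |gs|` (inputs, then one word pair per gate), and

* `cktSizeVia_operandFx` — an operand is fetched with `≤ 6 W` gates (variable: masked constant;
  constant: hard-wired rounded word; gate reference: wires; junk reference: the word of `0`);
* `cktSizeVia_prodStep` / `cktSizeVia_prodFold` — one multiply–shift–clamp step of a product gate
  and the whole left fold (`runStepCost W` gates per factor);
* `cktSizeVia_sumTerms` / `cktSizeVia_gateFx` — the rounded weighted sum of a sum gate, then the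
  clamp; any gate of fan-in `≤ 2` costs `gateCostFx W` gates;
* `cktSize_fxBus` — **the whole run**: the bus after `gs` is a `B₂`-circuit of size
  `|gs| · gateCostFx W` (list induction, as `cktSize_valBus` of the mod-`p` simulation).

Magnitude bookkeeping (why no word overflows, unconditionally): every stored value is a clamp
output (`|·| < 2^(I+B)`), a product of two such has components `< 2^(2(I+B)+1) ≤ 2^(W-1)`
(`abs_mul_lt_of_abs_lt`), shifts do not increase moduli, and a sum of at most two shifted
products is `< 2^(2(I+B)+2) ≤ 2^(W-1)` — this is where fan-in two enters.

Honest framing: circuit plumbing for a conditional route; `VP ≠ VNP` is NOT proved.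

## References

* P. Bürgisser, *Cook's versus Valiant's hypothesis*, TCS 235 (2000), §5 (A3) p. 86 (simulate the
  straight-line program gate by gate by Boolean circuits). [cite: Burgisser2000TCS, §5 (A3)]
* H. Vollmer, *Introduction to Circuit Complexity* (1999), §1.2–§1.3. [cite: Vollmer1999, §1.3]
-/

set_option linter.dupNamespace false

noncomputable section

namespace Summit.ValiantsHypothesis.ValiantsHypothesis.Theorems.NumTame

open Literature.Computability.AlgebraicComplexity Literature.Computability.Complexity FixedPoint
open ArithCircuit (Operand)

/-! ### Magnitudes -/

/-- Components of a product of Gaussian integers with components of modulus `< 2^K` have modulus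
`< 2^(2K+1)`. [folklore] -/
theorem abs_mul_lt_of_abs_lt {K : ℕ} {z w : GaussianInt}
    (hz : |z.re| < 2 ^ K ∧ |z.im| < 2 ^ K) (hw : |w.re| < 2 ^ K ∧ |w.im| < 2 ^ K) :
    |(z * w).re| < 2 ^ (2 * K + 1) ∧ |(z * w).im| < 2 ^ (2 * K + 1) := by
  have hK : (2 : ℤ) ^ (2 * K + 1) = 2 ^ K * 2 ^ K + 2 ^ K * 2 ^ K := by
    rw [pow_succ, two_mul K, pow_add]; ring
  have h1 : |z.re| * |w.re| < 2 ^ K * 2 ^ K :=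
    mul_lt_mul'' hz.1 hw.1 (abs_nonneg _) (abs_nonneg _)
  have h2 : |z.im| * |w.im| < 2 ^ K * 2 ^ K :=
    mul_lt_mul'' hz.2 hw.2 (abs_nonneg _) (abs_nonneg _)
  have h3 : |z.re| * |w.im| < 2 ^ K * 2 ^ K :=
    mul_lt_mul'' hz.1 hw.2 (abs_nonneg _) (abs_nonneg _)
  have h4 : |z.im| * |w.re| < 2 ^ K * 2 ^ K :=
    mul_lt_mul'' hz.2 hw.1 (abs_nonneg _) (abs_nonneg _)
  rw [Zsqrtd.re_mul, Zsqrtd.im_mul, hK]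
  constructor
  · calc |z.re * w.re + -1 * z.im * w.im| ≤ |z.re * w.re| + |-1 * z.im * w.im| := abs_add_le _ _
      _ = |z.re| * |w.re| + |z.im| * |w.im| := by
          rw [abs_mul, show -1 * z.im * w.im = -(z.im * w.im) by ring, abs_neg, abs_mul]
      _ < _ := add_lt_add h1 h2
  · calc |z.re * w.im + z.im * w.re| ≤ |z.re * w.im| + |z.im * w.re| := abs_add_le _ _
      _ = |z.re| * |w.im| + |z.im| * |w.re| := by rw [abs_mul, abs_mul]
      _ < _ := add_lt_add h3 h4

/-- The arithmetic shift does not increase moduli. [folklore] -/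
theorem abs_rshift_le (B : ℕ) (z : GaussianInt) :
    |(rshift B z).re| ≤ |z.re| ∧ |(rshift B z).im| ≤ |z.im| :=
  ⟨Int.abs_ediv_le_abs _ _, Int.abs_ediv_le_abs _ _⟩

section Run

variable {n : ℕ} (I B W : ℕ)

/-! ### Fetching an operand from the bus -/

/-- **Operand fetch** (`≤ 6 W` gates): the word pair of `operandFx I B x vals u` on the bus after
the gates `gs` (`vals = gateValuesFx I B x gs`). [cite: Burgisser2000TCS, §5 (A3)] -/
theorem cktSizeVia_operandFx (gs : List (ArithCircuit.Gate ℂ (Fin n))) (u : Operand ℂ (Fin n)) :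
    CktSizeVia (fun x : Fin n → Bool => fxBus W x (gateValuesFx I B x gs) gs.length)
      (fun x => gaussBits W (operandFx I B x (gateValuesFx I B x gs) u)) (6 * W) := by
  cases u with
  | var i =>
    exact (cktSizeVia_gaussIte (W := W) _ (Sum.inl i) (clamp (I + B) (2 ^ B))).congr fun x => by
      simp only [fxBus_inl]; rfl
  | const a =>
    exact ((cktSizeVia_gaussConst (W := W) _ (clamp (I + B) (ofComplex B a))).congr
      fun x => rfl).of_le (by omega)
  | gate j =>
    by_cases hj : j < gs.length
    · refine ((CktSizeVia.proj _ fun bi : Bool × Fin W =>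
        (Sum.inr (⟨j, hj⟩, bi) : Fin n ⊕ (Fin gs.length × (Bool × Fin W)))).congr
          fun x => ?_).of_le (Nat.zero_le _)
      funext bi
      simp only [fxBus_inr]
      rfl
    · refine ((cktSizeVia_gaussConst (W := W) _ 0).congr fun x => ?_).of_le (by omega)
      have hlen : (gateValuesFx I B x gs).length ≤ j := by
        rw [length_gateValuesFx]; omega
      simp only [operandFx, List.getD_eq_getElem?_getD, List.getElem?_eq_none hlen,
        Option.getD_none]

/-! ### One multiply–shift–clamp step and the product gate -/

/-- Gate count of one multiply–shift–clamp step (operand fetch, complex multiplication, arithmetic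
shift, clamp), as a function of the word width. [folklore] -/
theorem runStepCost_def (W B I : ℕ) :
    6 * W + (6 * modMulCost W + 3 * modAddCost W + 2 * W) +
        2 * (W * 1 + modAddCost W + 1 + W * 1 + modAddCost W) +
        (2 * (2 * (W * 1 + modAddCost W + (3 * W + 3)) + 1 + W * 1)) =
      6 * modMulCost W + 11 * modAddCost W + 30 * W + 16 + 0 * (B + I) := by
  ring

variable {I B W}

/-- **One product step** on the bus after `gs`: from the word pair of an accumulator `a x` in the
format (`|·| < 2^(I+B)`), the word pair of `clamp (I+B) (rshift B (a x * operandFx u))`, for word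
width `W ≥ 2 (I+B) + 4`. [cite: Burgisser2000TCS, §5 (A3)] -/
theorem cktSizeVia_prodStep (hW : 2 * (I + B) + 4 ≤ W) (gs : List (ArithCircuit.Gate ℂ (Fin n)))
    {a : (Fin n → Bool) → GaussianInt} {s : ℕ}
    (ha : CktSizeVia (fun x : Fin n → Bool => fxBus W x (gateValuesFx I B x gs) gs.length)
      (fun x => gaussBits W (a x)) s)
    (habs : ∀ x, |(a x).re| < 2 ^ (I + B) ∧ |(a x).im| < 2 ^ (I + B)) (u : Operand ℂ (Fin n)) :
    CktSizeVia (fun x : Fin n → Bool => fxBus W x (gateValuesFx I B x gs) gs.length)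
      (fun x => gaussBits W
        (clamp (I + B) (rshift B (a x * operandFx I B x (gateValuesFx I B x gs) u))))
      (s + (6 * modMulCost W + 11 * modAddCost W + 30 * W + 16)) := by
  set e := fun x : Fin n → Bool => fxBus W x (gateValuesFx I B x gs) gs.length with he
  set o := fun x : Fin n → Bool => operandFx I B x (gateValuesFx I B x gs) u with ho
  have hob : ∀ x, |(o x).re| < 2 ^ (I + B) ∧ |(o x).im| < 2 ^ (I + B) := fun x =>
    abs_operandFx_lt I B x _ (fun z hz => abs_lt_of_mem_gateValuesFx I B x gs z hz) u
  have h1 := ha.pair (cktSizeVia_operandFx I B W gs u)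
  have h2 := h1.trans ((cktSizeVia_gaussMul W).reparam fun x => (a x, o x))
  have hpow : (2 : ℤ) ^ (2 * (I + B) + 1) ≤ 2 ^ (W - 1) := pow_le_pow_right₀ (by norm_num) (by omega)
  have hprod : ∀ x, |(a x * o x).re| < 2 ^ (W - 1) ∧ |(a x * o x).im| < 2 ^ (W - 1) := fun x =>
    let h := abs_mul_lt_of_abs_lt (habs x) (hob x)
    ⟨h.1.trans_le hpow, h.2.trans_le hpow⟩
  have h3 := h2.trans ((cktSizeVia_gaussRshift W B (by omega)).reparam fun x => ⟨a x * o x, hprod x⟩)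
  have hsh : ∀ x, |(rshift B (a x * o x)).re| < 2 ^ (W - 1) ∧ |(rshift B (a x * o x)).im| < 2 ^ (W - 1) :=
    fun x => ⟨(abs_rshift_le B _).1.trans_lt (hprod x).1, (abs_rshift_le B _).2.trans_lt (hprod x).2⟩
  have h4 := h3.trans ((cktSizeVia_gaussClamp W (I + B) (by omega)).reparam
    fun x => ⟨rshift B (a x * o x), hsh x⟩)
  refine (h4.congr fun x => rfl).of_le (le_of_eq ?_)
  have := runStepCost_def W B I
  omega

/-- **The product gate's left fold**: `|args|` steps from any available accumulator in the
format. [cite: Burgisser2000TCS, §5 (A3)] -/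
theorem cktSizeVia_prodFold (hW : 2 * (I + B) + 4 ≤ W) (gs : List (ArithCircuit.Gate ℂ (Fin n))) :
    ∀ (args : List (Operand ℂ (Fin n))) {a : (Fin n → Bool) → GaussianInt} {s : ℕ},
      CktSizeVia (fun x : Fin n → Bool => fxBus W x (gateValuesFx I B x gs) gs.length)
        (fun x => gaussBits W (a x)) s →
      (∀ x, |(a x).re| < 2 ^ (I + B) ∧ |(a x).im| < 2 ^ (I + B)) →
      CktSizeVia (fun x : Fin n → Bool => fxBus W x (gateValuesFx I B x gs) gs.length)
        (fun x => gaussBits W (args.foldl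
          (fun acc u => clamp (I + B) (rshift B (acc * operandFx I B x (gateValuesFx I B x gs) u)))
          (a x)))
        (s + args.length * (6 * modMulCost W + 11 * modAddCost W + 30 * W + 16))
  | [], a, s, ha, _ => by
    simp only [List.foldl_nil, List.length_nil, zero_mul, add_zero]
    exact ha
  | u :: args, a, s, ha, habs => by
    have hstep := cktSizeVia_prodStep hW gs ha habs u
    have hb : ∀ x, |(clamp (I + B) (rshift B (a x * operandFx I B x (gateValuesFx I B x gs) u))).re|
        < 2 ^ (I + B) ∧
        |(clamp (I + B) (rshift B (a x * operandFx I B x (gateValuesFx I B x gs) u))).im|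
        < 2 ^ (I + B) := fun x => ⟨abs_re_clamp_lt _ _, abs_im_clamp_lt _ _⟩
    refine ((cktSizeVia_prodFold hW gs args hstep hb).congr fun x => ?_).of_le (le_of_eq ?_)
    · simp only [List.foldl_cons]
    · simp only [List.length_cons]; ring

/-! ### The sum gate -/

/-- **The rounded terms of a sum gate and their sum**: for each weighted operand `(a, u)` the word
pair of `rshift B (clamp (ofComplex B a) * operandFx u)`, accumulated exactly; together with the
magnitude bound `|Σ| ≤ |args| · 2^(2(I+B)+1)`. [cite: Burgisser2000TCS, §5 (A3)] -/
theorem cktSizeVia_sumTerms (hW : 2 * (I + B) + 4 ≤ W) (gs : List (ArithCircuit.Gate ℂ (Fin n))) :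
    ∀ args : List (ℂ × Operand ℂ (Fin n)),
      CktSizeVia (fun x : Fin n → Bool => fxBus W x (gateValuesFx I B x gs) gs.length)
        (fun x => gaussBits W ((args.map fun a => rshift B
          (clamp (I + B) (ofComplex B a.1) * operandFx I B x (gateValuesFx I B x gs) a.2)).sum))
        (2 * W + args.length * (2 * W + 6 * W + (6 * modMulCost W + 3 * modAddCost W + 2 * W) +
          2 * (W * 1 + modAddCost W + 1 + W * 1 + modAddCost W) + 2 * modAddCost W)) ∧
      ∀ x, |((args.map fun a => rshift B
          (clamp (I + B) (ofComplex B a.1) * operandFx I B x (gateValuesFx I B x gs) a.2)).sum).re|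
            ≤ args.length * 2 ^ (2 * (I + B) + 1) ∧
        |((args.map fun a => rshift B
          (clamp (I + B) (ofComplex B a.1) * operandFx I B x (gateValuesFx I B x gs) a.2)).sum).im|
            ≤ args.length * 2 ^ (2 * (I + B) + 1)
  | [] => by
    refine ⟨((cktSizeVia_gaussConst (W := W) _ 0).congr fun x => by simp).of_le (by omega), fun x => ?_⟩
    simp
  | a :: args => by
    obtain ⟨ih, ihb⟩ := cktSizeVia_sumTerms hW gs args
    set e := fun x : Fin n → Bool => fxBus W x (gateValuesFx I B x gs) gs.length with he
    set o := fun x : Fin n → Bool => operandFx I B x (gateValuesFx I B x gs) a.2 with ho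
    set c := clamp (I + B) (ofComplex B a.1) with hc
    have hcb : |c.re| < 2 ^ (I + B) ∧ |c.im| < 2 ^ (I + B) := ⟨abs_re_clamp_lt _ _, abs_im_clamp_lt _ _⟩
    have hob : ∀ x, |(o x).re| < 2 ^ (I + B) ∧ |(o x).im| < 2 ^ (I + B) := fun x =>
      abs_operandFx_lt I B x _ (fun z hz => abs_lt_of_mem_gateValuesFx I B x gs z hz) a.2
    -- the new term
    have h1 := (cktSizeVia_gaussConst (W := W) e c).pair (cktSizeVia_operandFx I B W gs a.2)
    have h2 := h1.trans ((cktSizeVia_gaussMul W).reparam fun x => (c, o x))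
    have hpow : (2 : ℤ) ^ (2 * (I + B) + 1) ≤ 2 ^ (W - 1) :=
      pow_le_pow_right₀ (by norm_num) (by omega)
    have hprod : ∀ x, |(c * o x).re| < 2 ^ (2 * (I + B) + 1) ∧ |(c * o x).im| < 2 ^ (2 * (I + B) + 1) :=
      fun x => abs_mul_lt_of_abs_lt hcb (hob x)
    have h3 := h2.trans ((cktSizeVia_gaussRshift W B (by omega)).reparam
      fun x => ⟨c * o x, (hprod x).1.trans_le hpow, (hprod x).2.trans_le hpow⟩)
    -- add it to the rest (the partial sum abstracted as `S` to keep unification cheap)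
    set S : (Fin n → Bool) → GaussianInt := fun x => (args.map fun a => rshift B
        (clamp (I + B) (ofComplex B a.1) * operandFx I B x (gateValuesFx I B x gs) a.2)).sum with hS
    have ih' : CktSizeVia e (fun x => gaussBits W (S x))
        (2 * W + args.length * (2 * W + 6 * W + (6 * modMulCost W + 3 * modAddCost W + 2 * W) +
          2 * (W * 1 + modAddCost W + 1 + W * 1 + modAddCost W) + 2 * modAddCost W)) := ih
    have h4 : CktSizeVia e (fun x => gaussBits W (rshift B (c * o x) + S x)) _ :=
      (h3.pair ih').trans ((cktSizeVia_gaussAdd W).reparam fun x => (rshift B (c * o x), S x))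
    refine ⟨(h4.congr fun x => by simp only [hS, hc, ho, List.map_cons, List.sum_cons]).of_le (le_of_eq ?_),
      fun x => ?_⟩
    · simp only [List.length_cons]; ring
    · have ht := abs_rshift_le B (c * o x)
      have hb := ihb x
      simp only [List.map_cons, List.sum_cons, Zsqrtd.re_add, Zsqrtd.im_add, List.length_cons,
        Nat.cast_succ]
      constructor
      · calc _ ≤ |(rshift B (c * o x)).re| + _ := abs_add_le _ _
          _ ≤ 2 ^ (2 * (I + B) + 1) + args.length * 2 ^ (2 * (I + B) + 1) :=
              add_le_add (ht.1.trans (hprod x).1.le) hb.1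
          _ = _ := by ring
      · calc _ ≤ |(rshift B (c * o x)).im| + _ := abs_add_le _ _
          _ ≤ 2 ^ (2 * (I + B) + 1) + args.length * 2 ^ (2 * (I + B) + 1) :=
              add_le_add (ht.2.trans (hprod x).2.le) hb.2
          _ = _ := by ring

/-! ### One gate of fan-in `≤ 2`, and the whole run -/

/-- Gate count per simulated arithmetic gate of fan-in `≤ 2` (both gate kinds), as a function of
the word width `W`. [folklore] -/
theorem gateCostFx_def (W : ℕ) :
    max (2 * W + 2 * (6 * modMulCost W + 11 * modAddCost W + 30 * W + 16))
        (2 * W + 2 * (2 * W + 6 * W + (6 * modMulCost W + 3 * modAddCost W + 2 * W) +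
          2 * (W * 1 + modAddCost W + 1 + W * 1 + modAddCost W) + 2 * modAddCost W) +
          (2 * (2 * (W * 1 + modAddCost W + (3 * W + 3)) + 1 + W * 1))) ≤
      12 * modMulCost W + 22 * modAddCost W + 62 * W + 32 := by
  refine max_le ?_ ?_ <;> ring_nf <;> omega

/-- **One gate** of fan-in `≤ 2` on the bus after `gs`: the word pair of
`gateFx I B x (gateValuesFx I B x gs) g` costs `≤ 12·modMulCost W + 22·modAddCost W + 56 W + 40`
gates. [cite: Burgisser2000TCS, §5 (A3)] -/
theorem cktSizeVia_gateFx (hW : 2 * (I + B) + 4 ≤ W) (gs : List (ArithCircuit.Gate ℂ (Fin n)))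
    (g : ArithCircuit.Gate ℂ (Fin n)) (hg : g.fanIn ≤ 2) :
    CktSizeVia (fun x : Fin n → Bool => fxBus W x (gateValuesFx I B x gs) gs.length)
      (fun x => gaussBits W (gateFx I B x (gateValuesFx I B x gs) g))
      (12 * modMulCost W + 22 * modAddCost W + 62 * W + 32) := by
  have hcost := gateCostFx_def W
  cases g with
  | prod args =>
    have hlen : args.length ≤ 2 := by
      simpa [ArithCircuit.Gate.fanIn, ArithCircuit.Gate.args] using hg
    have h0 : CktSizeVia (fun x : Fin n → Bool => fxBus W x (gateValuesFx I B x gs) gs.length)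
        (fun _ => gaussBits W (clamp (I + B) (2 ^ B))) (2 * W) := cktSizeVia_gaussConst _ _
    have h := cktSizeVia_prodFold hW gs args h0 fun _ => ⟨abs_re_clamp_lt _ _, abs_im_clamp_lt _ _⟩
    refine (h.congr fun x => rfl).of_le ?_
    calc 2 * W + args.length * (6 * modMulCost W + 11 * modAddCost W + 30 * W + 16)
        ≤ 2 * W + 2 * (6 * modMulCost W + 11 * modAddCost W + 30 * W + 16) :=
          Nat.add_le_add_left (Nat.mul_le_mul_right _ hlen) _
      _ ≤ _ := (le_max_left _ _).trans hcost
  | sum args =>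
    have hlen : args.length ≤ 2 := by
      simpa [ArithCircuit.Gate.fanIn, ArithCircuit.Gate.args] using hg
    obtain ⟨h, hb⟩ := cktSizeVia_sumTerms hW gs args
    set S : (Fin n → Bool) → GaussianInt := fun x => (args.map fun a => rshift B
        (clamp (I + B) (ofComplex B a.1) * operandFx I B x (gateValuesFx I B x gs) a.2)).sum with hS
    have h' : CktSizeVia (fun x : Fin n → Bool => fxBus W x (gateValuesFx I B x gs) gs.length)
        (fun x => gaussBits W (S x))
        (2 * W + args.length * (2 * W + 6 * W + (6 * modMulCost W + 3 * modAddCost W + 2 * W) +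
          2 * (W * 1 + modAddCost W + 1 + W * 1 + modAddCost W) + 2 * modAddCost W)) := h
    have hb' : ∀ x, |(S x).re| ≤ args.length * 2 ^ (2 * (I + B) + 1) ∧
        |(S x).im| ≤ args.length * 2 ^ (2 * (I + B) + 1) := hb
    have hpow : (args.length : ℤ) * 2 ^ (2 * (I + B) + 1) < 2 ^ (W - 1) := by
      have h2 : (args.length : ℤ) ≤ 2 := by exact_mod_cast hlen
      have hp : (0 : ℤ) < 2 ^ (2 * (I + B) + 1) := by positivity
      calc (args.length : ℤ) * 2 ^ (2 * (I + B) + 1) ≤ 2 * 2 ^ (2 * (I + B) + 1) :=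
            mul_le_mul_of_nonneg_right h2 hp.le
        _ = 2 ^ (2 * (I + B) + 2) := by rw [pow_succ]; ring
        _ < 2 ^ (W - 1) := pow_lt_pow_right₀ (by norm_num) (by omega)
    have h1 : CktSizeVia (fun x : Fin n → Bool => fxBus W x (gateValuesFx I B x gs) gs.length)
        (fun x => gaussBits W (clamp (I + B) (S x))) _ :=
      h'.trans ((cktSizeVia_gaussClamp W (I + B) (by omega)).reparam fun x =>
        ⟨S x, (hb' x).1.trans_lt hpow, (hb' x).2.trans_lt hpow⟩)
    refine (h1.congr fun x => by simp only [hS]; rfl).of_le ?_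
    calc _ ≤ 2 * W + 2 * (2 * W + 6 * W + (6 * modMulCost W + 3 * modAddCost W + 2 * W) +
          2 * (W * 1 + modAddCost W + 1 + W * 1 + modAddCost W) + 2 * modAddCost W) +
          (2 * (2 * (W * 1 + modAddCost W + (3 * W + 3)) + 1 + W * 1)) :=
          Nat.add_le_add_right (Nat.add_le_add_left (Nat.mul_le_mul_right _ hlen) _) _
      _ ≤ _ := (le_max_right _ _).trans hcost

/-- **The whole clamped fixed-point run as a `B₂`-circuit** (Bürgisser 2000 TCS, §5 (A3), p. 86,
archimedean version: simulate the straight-line program gate by gate): for word width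
`W ≥ 2 (I+B) + 4` and gates of fan-in `≤ 2`, the bus `fxBus W x (gateValuesFx I B x gs) |gs|` is
computed from `x` by `|gs| · (12·modMulCost W + 22·modAddCost W + 56 W + 40)` gates. [cite: Burgisser2000TCS, §5 (A3)] -/
theorem cktSize_fxBus (hW : 2 * (I + B) + 4 ≤ W) :
    ∀ gs : List (ArithCircuit.Gate ℂ (Fin n)), (∀ g ∈ gs, g.fanIn ≤ 2) →
      CktSize B2 (fun x : Fin n → Bool => fxBus W x (gateValuesFx I B x gs) gs.length)
        (gs.length * (12 * modMulCost W + 22 * modAddCost W + 62 * W + 32)) := by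
  intro gs
  induction gs using List.reverseRecOn with
  | nil =>
    intro _
    refine (((CktSize.id B2 (ι := Fin n)).outMap (Sum.elim (fun i => i)
      fun w : Fin ([] : List (ArithCircuit.Gate ℂ (Fin n))).length × (Bool × Fin W) =>
        w.1.elim0)).congr ?_).of_le (Nat.zero_le _)
    rintro x (i | w)
    · rfl
    · exact w.1.elim0
  | append_singleton gs g ih =>
    intro hall
    have hgs : ∀ g' ∈ gs, g'.fanIn ≤ 2 := fun g' hg' => hall g' (List.mem_append_left _ hg')
    have hg : g.fanIn ≤ 2 := hall g (List.mem_append_right _ (List.mem_singleton_self g))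
    have h1 := (CktSizeVia.of_cktSize_id (ih hgs)).trans ((cktSizeVia_gateFx hW gs g hg).extend)
    have h2 := h1.outMap fun w : Fin n ⊕ (Fin (gs ++ [g]).length × (Bool × Fin W)) =>
      (match w with
        | Sum.inl i => Sum.inl (Sum.inl i)
        | Sum.inr jb => if h : (jb.1 : ℕ) < gs.length then Sum.inl (Sum.inr (⟨jb.1, h⟩, jb.2))
            else Sum.inr jb.2 :
          (Fin n ⊕ (Fin gs.length × (Bool × Fin W))) ⊕ (Bool × Fin W))
    refine ((h2.congr fun x => ?_).toCktSize).of_le (le_of_eq ?_)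
    · funext w
      rcases w with i | ⟨j, bi⟩
      · rfl
      · rw [gateValuesFx_append_singleton]
        by_cases h : (j : ℕ) < gs.length
        · have hlt : (j : ℕ) < (gateValuesFx I B x gs).length := by rwa [length_gateValuesFx]
          simp [fxBus, h, List.getD_eq_getElem?_getD, List.getElem?_append_left hlt]
        · have hj : (j : ℕ) = (gateValuesFx I B x gs).length := by
            have := j.2
            simp only [List.length_append, List.length_singleton, length_gateValuesFx] at this ⊢
            omega
          simp [fxBus, List.getD_eq_getElem?_getD, hj]
    · simp only [List.length_append, List.length_singleton]
      ring

end Run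

end Summit.ValiantsHypothesis.ValiantsHypothesis.Theorems.NumTame

end
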